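import Mathlib

/-!
# A finite set of embeddings is determined by its product character

Blind re-derivation cell `pub-hodge-repro`, Tier 3, seat `t3-p2` (prover-pub-hodge-repro-t3-p2-g0-0).  Target
tree path `lean/Summits/Ventures/HodgeRepro/T3TypeNorm.lean`.  Imports: Mathlib only.

The elementary fact behind the CM-type bookkeeping of Route C's clause R4 (ROUTE-C §2 R4, §4 (c); the seat's
note `proofs/t3-p2/R3R4-INSTANTIATION.md` §2(v), residual R-f): Liu 2021 (arXiv:2102.11518) Definition 4.5,
store p0018:L53–75, pins the CM type of the Albanese factor `A_μ` by the DETERMINANT of the CM action on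
`Lie_E(A_μ)` — «for every `x ∈ M_μ`, the determinant of the action of `i_μ(x)` on the `E`-vector space
`Lie_E(A_μ)` equals `N_μ(x)`».  The determinant of `x` on the Lie algebra of an abelian variety with complex
multiplication by a number field `M` of CM type `Ψ` is the product `∏_{ψ ∈ Ψ} ψ(x)` (the type norm), so the
clause determines the type only if a finite set of embeddings is determined by its product character.  That is
what this file proves, in the generality of ring homomorphisms from a commutative ring `L` into a field `K` of
characteristic zero:

* `finset_eq_of_prod_eq` — if `∏_{ψ ∈ S} ψ(x) = ∏_{ψ ∈ S'} ψ(x)` for every `x : L`, then `S = S'`;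
* `prod_lift_eq_prod_map_norm` — the product character of the LIFT of a set `Φ'` of embeddings of a subfield `M'`
  to a finite extension `M` is `x ↦ ∏_{ψ ∈ Φ'} ψ(N_{M/M'} x)`: this is the shape of Liu's `N_μ = N′_μ ∘ N_{M_μ/M′_μ}`
  (Definition 4.5), so that the determinant clause reads «the type norm of `A_μ` is the type norm of the lift of the
  reflex type `Φ′_μ`», and `finset_eq_of_prod_eq` then identifies the CM type of `A_μ` with that lift.

Proof.  Cancel the common part `U = S ∩ S'` (which may vanish at finitely many shifts `x + n` only, `n ∈ ℕ`);
the two monic polynomials `∏_{ψ ∈ T} (X + ψ(x))`, `T = S ∖ S'`, and the same for `T' = S' ∖ S`, take equal values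
at infinitely many naturals, hence coincide, hence have equal subleading coefficients
`∑_{ψ ∈ T} ψ(x) = ∑_{ψ ∈ T'} ψ(x)`; Dedekind's independence of characters (Mathlib `linearIndependent_monoidHom`)
then forces `T = T' = ∅` since `T`, `T'` are disjoint.

Nothing here says anything about the status of the Hodge conjecture for CM abelian varieties, which is NOT proved.
-/

set_option autoImplicit false

namespace HodgeRepro.T3.TypeNorm

open Polynomial

variable {L K : Type*} [CommRing L] [Field K] [CharZero K]

omit [CharZero K] in
/-- Evaluating the monic polynomial `∏_{ψ ∈ T} (X + C (ψ x))` at a natural number `n` gives the product character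
at the shift `x + n`. -/
theorem eval_natCast_prod_X_add_C (T : Finset (L →+* K)) (x : L) (n : ℕ) :
    eval (n : K) (∏ ψ ∈ T, (X + C (ψ x))) = ∏ ψ ∈ T, ψ (x + n) := by
  simp only [eval_prod, eval_add, eval_X, eval_C, map_add, map_natCast]
  exact Finset.prod_congr rfl fun ψ _ => add_comm _ _

omit [CharZero K] in
/-- The subleading coefficient of `∏_{ψ ∈ T} (X + C (ψ x))` is the sum `∑_{ψ ∈ T} ψ x`. -/
theorem nextCoeff_prod_X_add_C (T : Finset (L →+* K)) (x : L) :
    nextCoeff (∏ ψ ∈ T, (X + C (ψ x))) = ∑ ψ ∈ T, ψ x := by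
  rw [Monic.nextCoeff_prod _ _ fun ψ _ => monic_X_add_C (ψ x)]
  simp only [nextCoeff_X_add_C]

/-- **Cancellation of a common factor, then comparison of the subleading coefficients.**  If
`(∏_{ψ ∈ T} ψ x) · (∏_{ψ ∈ U} ψ x) = (∏_{ψ ∈ T'} ψ x) · (∏_{ψ ∈ U} ψ x)` for every `x`, then
`∑_{ψ ∈ T} ψ x = ∑_{ψ ∈ T'} ψ x` for every `x`. -/
theorem sum_eq_of_prod_mul_eq (T T' U : Finset (L →+* K))
    (h : ∀ x : L, (∏ ψ ∈ T, ψ x) * ∏ ψ ∈ U, ψ x = (∏ ψ ∈ T', ψ x) * ∏ ψ ∈ U, ψ x) (x : L) :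
    ∑ ψ ∈ T, ψ x = ∑ ψ ∈ T', ψ x := by
  -- the naturals `n` at which the common factor vanishes form a finite set
  have hfin : Set.Finite {n : ℕ | ∏ ψ ∈ U, ψ (x + n) = 0} := by
    have hsub : {n : ℕ | ∏ ψ ∈ U, ψ (x + n) = 0} ⊆ ⋃ ψ ∈ U, {n : ℕ | (n : K) = -ψ x} := by
      intro n hn
      simp only [Set.mem_setOf_eq, Finset.prod_eq_zero_iff] at hn
      obtain ⟨ψ, hψ, h0⟩ := hn
      simp only [Set.mem_iUnion, Set.mem_setOf_eq]
      refine ⟨ψ, hψ, ?_⟩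
      rw [map_add, map_natCast] at h0
      exact eq_neg_of_add_eq_zero_right h0
    refine Set.Finite.subset (Set.Finite.biUnion (Finset.finite_toSet U) fun ψ _ => ?_) hsub
    refine Set.Subsingleton.finite fun a ha b hb => ?_
    exact Nat.cast_injective (ha.trans hb.symm)
  -- the two polynomials agree at the (infinitely many) remaining naturals
  have hinf : Set.Infinite
      {y : K | eval y (∏ ψ ∈ T, (X + C (ψ x))) = eval y (∏ ψ ∈ T', (X + C (ψ x)))} := by
    refine Set.infinite_of_injOn_mapsTo (f := fun n : ℕ => (n : K)) Nat.cast_injective.injOn ?_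
      hfin.infinite_compl
    intro n hn
    simp only [Set.mem_compl_iff, Set.mem_setOf_eq] at hn
    simp only [Set.mem_setOf_eq]
    rw [eval_natCast_prod_X_add_C, eval_natCast_prod_X_add_C]
    exact mul_right_cancel₀ hn (h (x + n))
  have hP : (∏ ψ ∈ T, (X + C (ψ x))) = ∏ ψ ∈ T', (X + C (ψ x)) := eq_of_infinite_eval_eq _ _ hinf
  rw [← nextCoeff_prod_X_add_C, ← nextCoeff_prod_X_add_C, hP]

/-- **Dedekind.**  Two disjoint finite sets of ring homomorphisms `L → K` whose sum characters agree are
both empty (`linearIndependent_monoidHom`, Dedekind's independence of characters). -/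
theorem eq_empty_of_disjoint_of_sum_eq (T T' : Finset (L →+* K)) (hd : Disjoint T T')
    (h : ∀ x : L, ∑ ψ ∈ T, ψ x = ∑ ψ ∈ T', ψ x) : T = ∅ ∧ T' = ∅ := by
  classical
  have hli : LinearIndependent K (fun ψ : L →+* K => ((ψ : L →* K) : L → K)) :=
    (linearIndependent_monoidHom L K).comp (fun ψ : L →+* K => (ψ : L →* K))
      RingHom.coe_monoidHom_injective
  rw [linearIndependent_iff'] at hli
  have key := hli (T ∪ T') (fun ψ => if ψ ∈ T then (1 : K) else -1) ?_
  · constructor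
    · refine Finset.eq_empty_of_forall_notMem fun ψ hψ => ?_
      have := key ψ (Finset.mem_union_left _ hψ)
      simp [hψ] at this
    · refine Finset.eq_empty_of_forall_notMem fun ψ hψ => ?_
      have hnot : ψ ∉ T := Finset.disjoint_right.1 hd hψ
      have := key ψ (Finset.mem_union_right _ hψ)
      simp [hnot] at this
  · rw [Finset.sum_union hd]
    funext x
    simp only [Finset.sum_apply, Pi.smul_apply, Pi.add_apply, Pi.zero_apply, smul_eq_mul,
      MonoidHom.coe_coe]
    have hT : ∑ ψ ∈ T, (if ψ ∈ T then (1 : K) else -1) * ψ x = ∑ ψ ∈ T, ψ x :=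
      Finset.sum_congr rfl fun ψ hψ => by rw [if_pos hψ, one_mul]
    have hT' : ∑ ψ ∈ T', (if ψ ∈ T then (1 : K) else -1) * ψ x = -∑ ψ ∈ T', ψ x := by
      rw [← Finset.sum_neg_distrib]
      exact Finset.sum_congr rfl fun ψ hψ => by
        rw [if_neg (Finset.disjoint_right.1 hd hψ), neg_one_mul]
    rw [hT, hT', h x, add_neg_cancel]

/-- **A finite set of ring homomorphisms `L → K` is determined by its product character.**  For `K` a field
of characteristic zero: if `∏_{ψ ∈ S} ψ x = ∏_{ψ ∈ S'} ψ x` for every `x : L`, then `S = S'`.  Applied to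
`L = M_μ` a CM field and `K = ℂ`, with `S`, `S'` two CM types: the type norm `x ↦ ∏_{ψ ∈ Ψ} ψ(x)` — the
determinant of `x` on the Lie algebra of an abelian variety of CM type `(M_μ, Ψ)` — determines `Ψ`. -/
theorem finset_eq_of_prod_eq (S S' : Finset (L →+* K))
    (h : ∀ x : L, ∏ ψ ∈ S, ψ x = ∏ ψ ∈ S', ψ x) : S = S' := by
  classical
  have hmul : ∀ x : L, (∏ ψ ∈ S \ S', ψ x) * ∏ ψ ∈ S ∩ S', ψ x
      = (∏ ψ ∈ S' \ S, ψ x) * ∏ ψ ∈ S ∩ S', ψ x := by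
    intro x
    rw [← Finset.sdiff_inter_self_left S S', Finset.prod_sdiff Finset.inter_subset_left, h x,
      ← Finset.prod_sdiff (Finset.inter_subset_right : S ∩ S' ⊆ S'),
      Finset.sdiff_inter_self_right S' S]
  have hsum := sum_eq_of_prod_mul_eq _ _ _ hmul
  obtain ⟨h1, h2⟩ := eq_empty_of_disjoint_of_sum_eq _ _ disjoint_sdiff_sdiff hsum
  exact Finset.Subset.antisymm (Finset.sdiff_eq_empty_iff_subset.1 h1)
    (Finset.sdiff_eq_empty_iff_subset.1 h2)

/-! ### The lift of a set of embeddings and the relative norm -/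

section Lift

variable {M' M : Type*} [Field M'] [Field M] [Algebra M' M] [FiniteDimensional M' M] [CharZero M']

/-- **One fibre.**  The embeddings `χ : M → ℂ` extending a fixed `ψ : M' → ℂ` are the `M'`-algebra homomorphisms
for the `M'`-algebra structure `ψ` on `ℂ`, and the product of their values at `x` is `ψ(N_{M/M'} x)`
(Mathlib `Algebra.norm_eq_prod_embeddings`). -/
theorem prod_fiber_eq_map_norm (ψ : M' →+* ℂ) (Ψ : Finset (M →+* ℂ))
    (hΨ : ∀ χ : M →+* ℂ, χ ∈ Ψ ↔ χ.comp (algebraMap M' M) = ψ) (x : M) :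
    ∏ χ ∈ Ψ, χ x = ψ (Algebra.norm M' x) := by
  letI : Algebra M' ℂ := ψ.toAlgebra
  have hnorm := Algebra.norm_eq_prod_embeddings M' ℂ x
  rw [RingHom.algebraMap_toAlgebra] at hnorm
  rw [hnorm]
  refine Finset.prod_bij' (fun χ hχ => (⟨χ, fun r => RingHom.congr_fun ((hΨ χ).1 hχ) r⟩ : M →ₐ[M'] ℂ))
    (fun σ _ => (σ : M →+* ℂ)) (fun _ _ => Finset.mem_univ _) (fun σ _ => ?_) (fun _ _ => rfl)
    (fun σ _ => AlgHom.ext fun _ => rfl) (fun _ _ => rfl)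
  exact (hΨ _).2 (RingHom.ext fun r => σ.commutes r)

/-- **The lift.**  If `Ψ` is the set of embeddings `M → ℂ` whose restriction to `M'` lies in `Φ'` (the lift of `Φ'`
to `M`), then `∏_{χ ∈ Ψ} χ x = ∏_{ψ ∈ Φ'} ψ(N_{M/M'} x)` for every `x : M`. -/
theorem prod_lift_eq_prod_map_norm (Φ' : Finset (M' →+* ℂ)) (Ψ : Finset (M →+* ℂ))
    (hΨ : ∀ χ : M →+* ℂ, χ ∈ Ψ ↔ χ.comp (algebraMap M' M) ∈ Φ') (x : M) :
    ∏ χ ∈ Ψ, χ x = ∏ ψ ∈ Φ', ψ (Algebra.norm M' x) := by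
  classical
  rw [← Finset.prod_fiberwise_of_maps_to (g := fun χ : M →+* ℂ => χ.comp (algebraMap M' M))
    (t := Φ') (fun χ h => (hΨ χ).1 h)]
  refine Finset.prod_congr rfl fun ψ hψ => ?_
  refine prod_fiber_eq_map_norm ψ _ (fun χ => ?_) x
  simp only [Finset.mem_filter]
  exact ⟨fun h => h.2, fun h => ⟨(hΨ χ).2 (h ▸ hψ), h⟩⟩

end Lift

end HodgeRepro.T3.TypeNorm
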